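import Literature.AlgebraicGeometry.Motives.HodgeStructureIntegralLatticeExteriorPowers
import Literature.AlgebraicGeometry.Motives.HodgeStructureIntegralLatticePoincareDuality
import Literature.AlgebraicGeometry.Motives.HodgeStructureExteriorAlgebraCorrespondences
import Literature.AlgebraicGeometry.Motives.HodgeStructureExteriorAlgebraWeylOperatorDirectSum
import HarnessLib

/-!
# Integral Künneth and integral correspondences: `H•(X × Y, ℤ) = H•(X, ℤ) ⊗ H•(Y, ℤ)` inside `⋀(W₁ × W₂)`, and an integral
# correspondence `u ∈ H•(X × Y, ℤ)` acts integrally, `ū(H•(X, ℤ)) ⊆ H•(Y, ℤ)` (Bourbaki, *Algebra* III §7 no. 7 Prop. 10; Milne 1999 §5)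

[topic AlgebraicGeometry/Motives]

Layer `Literature/AlgebraicGeometry/Motives` (namespace `Literature.AlgebraicGeometry.Motives.ExteriorLefschetz`), lane `lit-hodgefound`
(Track 2 foundations library; prover seat `lit-hodgefound-p34`, generation 39, row g39-#8 — the generation's theme «integral structures on
`H•(X) = ⋀W`» on PRODUCTS).  THEOREMS ONLY (no `def`, no named fact, no instance, no notation; D-0026 net debt `0`).  Sequel of
g39-#1/#2/#5 (`HodgeStructureFourierTransformIntegralLattice`, `…IntegralLatticePoincareDuality`, `…IntegralLatticeExteriorPowers`: the
lattice `L(b) = span_ℤ {w_A} = H•(X, ℤ)` of a Darboux basis `b`, a subring, `= ⟨ι(Λ)⟩` the subring generated by `ι(H¹(X, ℤ))`, with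
`τ_θ(L ∧ L) ⊆ ℤ`), of g32-#1/#2 (`HodgeStructureExteriorAlgebraKunnethGysin`, `…Correspondences`: `p^* = ⋀(inl)`, `q^* = ⋀(inr)`, the Gysin
map `q_* = gysinSnd ω₁ g₁` with `q_*(p^*a ∧ q^*b) = τ_{ω₁}(a) b`, Milne's dictionary `ū = corrMap ω₁ g₁ u`, `ū(x) = q_*(p^*x ∧ u)`) and of
g36 (`HodgeStructureExteriorAlgebraWeylOperatorDirectSum`: the concatenated Darboux basis of `W₁ × W₂` and its 2-vector `θ₁ ⊞ θ₂`).

THE SETTING.  `K` a field of characteristic `0`; `bᵢ` a Darboux basis of `Wᵢ = H¹(Xᵢ, K)` (genus `gᵢ`), `Λᵢ = span_ℤ(range bᵢ) =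
H¹(Xᵢ, ℤ)`, `Lᵢ = L(bᵢ) = span_ℤ {w_A(bᵢ)} = H•(Xᵢ, ℤ) ⊂ ⋀Wᵢ`; on `X₁ × X₂`: `H•(X₁ × X₂) = ⋀(W₁ × W₂)`, `p^* = ⋀(inl)`, `q^* = ⋀(inr)`,
and the KÜNNETH LATTICE `L₁ ⊠ L₂ := span_ℤ {p^*w_A ∧ q^*w_B}` — written out as
`Submodule.span ℤ (Set.image2 (fun x y ↦ ⋀(inl) x * ⋀(inr) y) (range (weightBasis b₁)) (range (weightBasis b₂)))`.

## Sources, VERBATIM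

* N. Bourbaki, *Algebra I*, Ch. III §7 no. 7, Proposition 10 [BourbakiAlgebraI1989]: for modules `M`, `N` over a commutative ring `A`,
  "the canonical homomorphism `⋀(M) ᵍ⊗_A ⋀(N) → ⋀(M ⊕ N)`" (`x ⊗ y ↦ ⋀(i₁)(x) ∧ ⋀(i₂)(y)`) "is an isomorphism of graded algebras" —
  applied over `A = ℤ` to `Λ₁ ⊕ Λ₂ = H¹(X₁ × X₂, ℤ)`: `H•(X₁ × X₂, ℤ) = ⋀_ℤ(Λ₁ ⊕ Λ₂)^∨ = ⋀_ℤ Λ₁^∨ ⊗ ⋀_ℤ Λ₂^∨ = H•(X₁, ℤ) ⊗ H•(X₂, ℤ)`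
  (the torsion-free Künneth formula for complex tori), with H. Lange, *Abelian Varieties over the Complex Numbers* (2023)
  [Lange2023AbelianVarietiesComplex], §1.1.3 Lemma 1.1.17 and Exercise 1.1.6 (7) ("the canonical map `⋀ⁿH¹(X, ℤ) → Hⁿ(X, ℤ)` induced by
  the cup product is an isomorphism").
* J. S. Milne, *Lefschetz classes on abelian varieties*, Duke Math. J. **96** (1999) [Milne1999LefschetzClasses], §5 p. 664 (held text
  `paper:doi-10-1215-s0012-7094-99-09620-5`, p0026): "The map sending `u ∈ H^{2s}(X × Y)(s)` to the composite
  `H^*(X) —p^*→ H^*(X × Y) —(v ↦ v ∪ u)→ H^{*+2s}(X × Y)(s) —q_*→ H^{*+2s−2d}(Y)(s − d)`, `d = dim X`, is an isomorphism `u ↦ ū`".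
  Since `p^*`, `∪` and `q_*` are defined on integral cohomology, `ū` maps `H^*(X, ℤ)` to `H^*(Y, ℤ)` whenever `u ∈ H^*(X × Y, ℤ)`; in the
  model this is PROVED (§3) from the projection formula `q_*(p^*a ∧ q^*b) = τ_{θ₁}(a) b` and the integrality `τ_{θ₁}(H•(X, ℤ)) ⊆ ℤ` of
  g39-#2.

## Contents (all proved)

* §1 the Künneth lattice is a subring containing `p^*L₁` and `q^*L₂`: `map_inl_mul_map_inr_mem_kunnethSpan`, `one_mem_kunnethSpan`,
  `map_inl_mem_kunnethSpan`, `map_inr_mem_kunnethSpan`, `map_inr_weightBasis_mul_map_inl_weightBasis` (graded commutation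
  `q^*w_B ∧ p^*w_C = (−1)^{|B||C|} p^*w_C ∧ q^*w_B`), **`mul_mem_kunnethSpan`**, `neg_mem`/closure form `kunnethSpan_closure_le`.
* §2 **`span_weightBasis_prod_eq_kunnethSpan`** — INTEGRAL KÜNNETH: for the concatenated Darboux basis `b₁₂` of `W₁ × W₂`,
  `L(b₁₂) = L₁ ⊠ L₂` (both are the subring generated by `ι(Λ₁ ⊕ Λ₂)`), with the two inclusions `ι_mem_kunnethSpan_of_mem_span_prod`,
  `map_inl_mem_span_weightBasis_prod`, `map_inr_mem_span_weightBasis_prod`.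
* §3 INTEGRAL CORRESPONDENCES: **`corrMap_mem_span_weightBasis`** (`u ∈ L₁ ⊠ L₂`, `x ∈ L₁ ⟹ ū(x) ∈ L₂`),
  **`corrMap_mem_span_weightBasis_of_mem_span_prod`** (the same for `u ∈ L(b₁₂) = H•(X₁ × X₂, ℤ)`), and
  `exists_trace_inl_add_inr_eq_intCast` (`τ_{θ₁ ⊞ θ₂}(u) ∈ ℤ` for `u ∈ L₁ ⊠ L₂`).
-/

open scoped TensorProduct

namespace Literature.AlgebraicGeometry.Motives

namespace ExteriorLefschetz

open ExteriorAlgebra Module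
open Literature.LinearAlgebra.Alternating (map_coe_mem_exteriorPower mul_comm_of_mem_exteriorPower)

variable {K : Type*} [Field K] [CharZero K] {W₁ W₂ : Type*} [AddCommGroup W₁] [Module K W₁] [AddCommGroup W₂] [Module K W₂]
  {g₁ g₂ : ℕ} (b₁ : Basis (Fin g₁ ⊕ Fin g₁) K W₁) (b₂ : Basis (Fin g₂ ⊕ Fin g₂) K W₂)

/-! ## §1 The Künneth lattice `L₁ ⊠ L₂ = span_ℤ {p^*w_A ∧ q^*w_B}` is a subring containing `p^*L₁` and `q^*L₂` -/

omit [CharZero K] in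
/-- `p^*x ∧ q^*y ∈ L₁ ⊠ L₂` for `x ∈ L₁`, `y ∈ L₂` (bilinearity). [cite: BourbakiAlgebraI1989, Ch. III §7 no. 7 Prop. 10] -/
theorem map_inl_mul_map_inr_mem_kunnethSpan {x : ExteriorAlgebra K W₁} {y : ExteriorAlgebra K W₂}
    (hx : x ∈ Submodule.span ℤ (Set.range (weightBasis b₁))) (hy : y ∈ Submodule.span ℤ (Set.range (weightBasis b₂))) :
    ExteriorAlgebra.map (LinearMap.inl K W₁ W₂) x * ExteriorAlgebra.map (LinearMap.inr K W₁ W₂) y ∈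
      Submodule.span ℤ (Set.image2 (fun x y ↦ ExteriorAlgebra.map (LinearMap.inl K W₁ W₂) x * ExteriorAlgebra.map (LinearMap.inr K W₁ W₂) y)
        (Set.range (weightBasis b₁)) (Set.range (weightBasis b₂))) := by
  induction hx using Submodule.span_induction generalizing y with
  | mem x hx =>
    induction hy using Submodule.span_induction with
    | mem y hy => exact Submodule.subset_span (Set.mem_image2_of_mem hx hy)
    | zero => rw [map_zero, mul_zero]; exact Submodule.zero_mem _
    | add y z _ _ hy hz => rw [map_add, mul_add]; exact Submodule.add_mem _ hy hz
    | smul n y _ hy => rw [map_zsmul, mul_smul_comm]; exact Submodule.smul_mem _ n hy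
  | zero => rw [map_zero, zero_mul]; exact Submodule.zero_mem _
  | add x z _ _ hx hz => rw [map_add, add_mul]; exact Submodule.add_mem _ (hx hy) (hz hy)
  | smul n x _ hx => rw [map_zsmul, smul_mul_assoc]; exact Submodule.smul_mem _ n (hx hy)

omit [CharZero K] in
/-- `p^*x ∈ L₁ ⊠ L₂` for `x ∈ L₁` (`q^*1 = 1`). [cite: BourbakiAlgebraI1989, Ch. III §7 no. 7 Prop. 10] -/
theorem map_inl_mem_kunnethSpan {x : ExteriorAlgebra K W₁} (hx : x ∈ Submodule.span ℤ (Set.range (weightBasis b₁))) :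
    ExteriorAlgebra.map (LinearMap.inl K W₁ W₂) x ∈
      Submodule.span ℤ (Set.image2 (fun x y ↦ ExteriorAlgebra.map (LinearMap.inl K W₁ W₂) x * ExteriorAlgebra.map (LinearMap.inr K W₁ W₂) y)
        (Set.range (weightBasis b₁)) (Set.range (weightBasis b₂))) := by
  have h1 := map_inl_mul_map_inr_mem_kunnethSpan b₁ b₂ hx (one_mem_span_weightBasis b₂)
  rwa [map_one, mul_one] at h1

omit [CharZero K] in
/-- `q^*y ∈ L₁ ⊠ L₂` for `y ∈ L₂` (`p^*1 = 1`). [cite: BourbakiAlgebraI1989, Ch. III §7 no. 7 Prop. 10] -/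
theorem map_inr_mem_kunnethSpan {y : ExteriorAlgebra K W₂} (hy : y ∈ Submodule.span ℤ (Set.range (weightBasis b₂))) :
    ExteriorAlgebra.map (LinearMap.inr K W₁ W₂) y ∈
      Submodule.span ℤ (Set.image2 (fun x y ↦ ExteriorAlgebra.map (LinearMap.inl K W₁ W₂) x * ExteriorAlgebra.map (LinearMap.inr K W₁ W₂) y)
        (Set.range (weightBasis b₁)) (Set.range (weightBasis b₂))) := by
  have h1 := map_inl_mul_map_inr_mem_kunnethSpan b₁ b₂ (one_mem_span_weightBasis b₁) hy
  rwa [map_one, one_mul] at h1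

omit [CharZero K] in
/-- `1 ∈ L₁ ⊠ L₂`. [cite: BourbakiAlgebraI1989, Ch. III §7 no. 7 Prop. 10] -/
theorem one_mem_kunnethSpan :
    (1 : ExteriorAlgebra K (W₁ × W₂)) ∈
      Submodule.span ℤ (Set.image2 (fun x y ↦ ExteriorAlgebra.map (LinearMap.inl K W₁ W₂) x * ExteriorAlgebra.map (LinearMap.inr K W₁ W₂) y)
        (Set.range (weightBasis b₁)) (Set.range (weightBasis b₂))) := by
  have h1 := map_inl_mem_kunnethSpan b₁ b₂ (one_mem_span_weightBasis b₁)
  rwa [map_one] at h1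

omit [CharZero K] in
/-- **Graded commutation of the two factors: `q^*w_B ∧ p^*w_C = (−1)^{|B||C|} p^*w_C ∧ q^*w_B`** (`⋀(W₁ × W₂)` is anticommutative;
Bourbaki's "`ᵍ⊗`", the graded tensor product). [cite: BourbakiAlgebraI1989, Ch. III §7 no. 7 Prop. 10 and no. 3 Cor. 2 to Prop. 5] -/
theorem map_inr_weightBasis_mul_map_inl_weightBasis (B : Finset (Fin g₂ ×ₗ Bool)) (C : Finset (Fin g₁ ×ₗ Bool)) :
    ExteriorAlgebra.map (LinearMap.inr K W₁ W₂) (weightBasis b₂ B) * ExteriorAlgebra.map (LinearMap.inl K W₁ W₂) (weightBasis b₁ C) =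
      (-1 : ℤˣ) ^ (C.card * B.card) •
        (ExteriorAlgebra.map (LinearMap.inl K W₁ W₂) (weightBasis b₁ C) * ExteriorAlgebra.map (LinearMap.inr K W₁ W₂) (weightBasis b₂ B)) :=
  mul_comm_of_mem_exteriorPower K (map_coe_mem_exteriorPower K (LinearMap.inr K W₁ W₂) ⟨_, weightBasis_mem b₂ B⟩)
    (map_coe_mem_exteriorPower K (LinearMap.inl K W₁ W₂) ⟨_, weightBasis_mem b₁ C⟩)

omit [CharZero K] in
/-- **The Künneth lattice is closed under the product**: `(p^*w_A ∧ q^*w_B) ∧ (p^*w_C ∧ q^*w_D) = ± p^*(w_A ∧ w_C) ∧ q^*(w_B ∧ w_D)` and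
`Lᵢ` are subrings. [cite: BourbakiAlgebraI1989, Ch. III §7 no. 7 Prop. 10 ("isomorphism of graded algebras")] -/
theorem mul_mem_kunnethSpan {u v : ExteriorAlgebra K (W₁ × W₂)}
    (hu : u ∈ Submodule.span ℤ (Set.image2 (fun x y ↦ ExteriorAlgebra.map (LinearMap.inl K W₁ W₂) x * ExteriorAlgebra.map (LinearMap.inr K W₁ W₂) y)
        (Set.range (weightBasis b₁)) (Set.range (weightBasis b₂))))
    (hv : v ∈ Submodule.span ℤ (Set.image2 (fun x y ↦ ExteriorAlgebra.map (LinearMap.inl K W₁ W₂) x * ExteriorAlgebra.map (LinearMap.inr K W₁ W₂) y)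
        (Set.range (weightBasis b₁)) (Set.range (weightBasis b₂)))) :
    u * v ∈ Submodule.span ℤ (Set.image2 (fun x y ↦ ExteriorAlgebra.map (LinearMap.inl K W₁ W₂) x * ExteriorAlgebra.map (LinearMap.inr K W₁ W₂) y)
        (Set.range (weightBasis b₁)) (Set.range (weightBasis b₂))) := by
  induction hu using Submodule.span_induction generalizing v with
  | mem u hu =>
    obtain ⟨x, ⟨A, rfl⟩, y, ⟨B, rfl⟩, rfl⟩ := hu
    induction hv using Submodule.span_induction with
    | mem v hv =>
      obtain ⟨x', ⟨C, rfl⟩, y', ⟨D, rfl⟩, rfl⟩ := hv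
      have h1 : ExteriorAlgebra.map (LinearMap.inl K W₁ W₂) (weightBasis b₁ A) * ExteriorAlgebra.map (LinearMap.inr K W₁ W₂) (weightBasis b₂ B) *
          (ExteriorAlgebra.map (LinearMap.inl K W₁ W₂) (weightBasis b₁ C) * ExteriorAlgebra.map (LinearMap.inr K W₁ W₂) (weightBasis b₂ D)) =
          (-1 : ℤˣ) ^ (C.card * B.card) • (ExteriorAlgebra.map (LinearMap.inl K W₁ W₂) (weightBasis b₁ A * weightBasis b₁ C) *
            ExteriorAlgebra.map (LinearMap.inr K W₁ W₂) (weightBasis b₂ B * weightBasis b₂ D)) := by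
        rw [map_mul, map_mul, mul_assoc, ← mul_assoc (ExteriorAlgebra.map (LinearMap.inr K W₁ W₂) (weightBasis b₂ B)),
          map_inr_weightBasis_mul_map_inl_weightBasis, smul_mul_assoc, mul_smul_comm, mul_assoc, mul_assoc]
      rw [h1, Units.smul_def]
      exact Submodule.smul_mem _ _ (map_inl_mul_map_inr_mem_kunnethSpan b₁ b₂
        (mul_mem_span_weightBasis b₁ (Submodule.subset_span ⟨A, rfl⟩) (Submodule.subset_span ⟨C, rfl⟩))
        (mul_mem_span_weightBasis b₂ (Submodule.subset_span ⟨B, rfl⟩) (Submodule.subset_span ⟨D, rfl⟩)))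
    | zero => rw [mul_zero]; exact Submodule.zero_mem _
    | add v w _ _ hv hw => rw [mul_add]; exact Submodule.add_mem _ hv hw
    | smul n v _ hv => rw [mul_smul_comm]; exact Submodule.smul_mem _ n hv
  | zero => rw [zero_mul]; exact Submodule.zero_mem _
  | add u w _ _ hu hw => rw [add_mul]; exact Submodule.add_mem _ (hu hv) (hw hv)
  | smul n u _ hu => rw [smul_mul_assoc]; exact Submodule.smul_mem _ n (hu hv)

/-! ## §2 Integral Künneth: `L(b₁₂) = L₁ ⊠ L₂` for the concatenated Darboux basis `b₁₂` of `W₁ × W₂` -/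

omit [CharZero K] in
/-- The letters of the concatenated Darboux basis are `inl(b₁ i)` and `inr(b₂ j)`: its lattice `Λ₁₂` is spanned by
`inl(range b₁) ∪ inr(range b₂)`, so `ι(Λ₁₂) ⊆ L₁ ⊠ L₂`. [cite: BourbakiAlgebraI1989, Ch. III §7 no. 7 Prop. 10] -/
theorem ι_mem_kunnethSpan_of_mem_span_prod {v : W₁ × W₂}
    (hv : v ∈ Submodule.span ℤ (Set.range ((b₁.prod b₂).reindex
      ((Equiv.sumSumSumComm (Fin g₁) (Fin g₁) (Fin g₂) (Fin g₂)).trans (Equiv.sumCongr finSumFinEquiv finSumFinEquiv))))) :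
    ι K v ∈ Submodule.span ℤ (Set.image2 (fun x y ↦ ExteriorAlgebra.map (LinearMap.inl K W₁ W₂) x * ExteriorAlgebra.map (LinearMap.inr K W₁ W₂) y)
        (Set.range (weightBasis b₁)) (Set.range (weightBasis b₂))) := by
  rw [Module.Basis.range_reindex] at hv
  induction hv using Submodule.span_induction with
  | mem w hw =>
    obtain ⟨k, rfl⟩ := hw
    rcases k with i | j
    · rw [Module.Basis.prod_apply, Sum.elim_inl, Function.comp_apply, ← ExteriorAlgebra.map_apply_ι]
      exact map_inl_mem_kunnethSpan b₁ b₂ (ι_basis_mem_span_weightBasis b₁ i)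
    · rw [Module.Basis.prod_apply, Sum.elim_inr, Function.comp_apply, ← ExteriorAlgebra.map_apply_ι]
      exact map_inr_mem_kunnethSpan b₁ b₂ (ι_basis_mem_span_weightBasis b₂ j)
  | zero => rw [map_zero]; exact Submodule.zero_mem _
  | add w w' _ _ hw hw' => rw [map_add]; exact Submodule.add_mem _ hw hw'
  | smul n w _ hw => rw [map_zsmul]; exact Submodule.smul_mem _ n hw

omit [CharZero K] in
/-- **`L(b₁₂) ⊆ L₁ ⊠ L₂`**: `L(b₁₂)` is the subring generated by `ι(Λ₁₂)` (g39-#5), and `L₁ ⊠ L₂` is a subring containing `ι(Λ₁₂)`.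
[cite: BourbakiAlgebraI1989, Ch. III §7 no. 7 Prop. 10] [cite: Lange2023AbelianVarietiesComplex, §1.1.3 Lemma 1.1.17 and Exercise 1.1.6 (7)] -/
theorem mem_kunnethSpan_of_mem_span_weightBasis_prod {u : ExteriorAlgebra K (W₁ × W₂)}
    (hu : u ∈ Submodule.span ℤ (Set.range (weightBasis ((b₁.prod b₂).reindex
      ((Equiv.sumSumSumComm (Fin g₁) (Fin g₁) (Fin g₂) (Fin g₂)).trans (Equiv.sumCongr finSumFinEquiv finSumFinEquiv)))))) :
    u ∈ Submodule.span ℤ (Set.image2 (fun x y ↦ ExteriorAlgebra.map (LinearMap.inl K W₁ W₂) x * ExteriorAlgebra.map (LinearMap.inr K W₁ W₂) y)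
        (Set.range (weightBasis b₁)) (Set.range (weightBasis b₂))) := by
  rw [mem_span_weightBasis_iff_mem_closure] at hu
  induction hu using Subring.closure_induction with
  | mem y hy =>
    obtain ⟨v, hv, rfl⟩ := hy
    exact ι_mem_kunnethSpan_of_mem_span_prod b₁ b₂ hv
  | zero => exact Submodule.zero_mem _
  | one => exact one_mem_kunnethSpan b₁ b₂
  | add y z _ _ hy hz => exact Submodule.add_mem _ hy hz
  | neg y _ hy => exact Submodule.neg_mem _ hy
  | mul y z _ _ hy hz => exact mul_mem_kunnethSpan b₁ b₂ hy hz

omit [CharZero K] in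
/-- `inl(Λ₁) ⊆ Λ₁₂`. [cite: BourbakiAlgebraI1989, Ch. III §7 no. 7 Prop. 10] -/
theorem inl_mem_span_prod_of_mem_span {v : W₁} (hv : v ∈ Submodule.span ℤ (Set.range b₁)) :
    LinearMap.inl K W₁ W₂ v ∈ Submodule.span ℤ (Set.range ((b₁.prod b₂).reindex
      ((Equiv.sumSumSumComm (Fin g₁) (Fin g₁) (Fin g₂) (Fin g₂)).trans (Equiv.sumCongr finSumFinEquiv finSumFinEquiv)))) := by
  rw [Module.Basis.range_reindex]
  induction hv using Submodule.span_induction with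
  | mem w hw =>
    obtain ⟨i, rfl⟩ := hw
    refine Submodule.subset_span ⟨Sum.inl i, ?_⟩
    rw [Module.Basis.prod_apply, Sum.elim_inl, Function.comp_apply]
  | zero => rw [map_zero]; exact Submodule.zero_mem _
  | add w w' _ _ hw hw' => rw [map_add]; exact Submodule.add_mem _ hw hw'
  | smul n w _ hw => rw [map_zsmul]; exact Submodule.smul_mem _ n hw

omit [CharZero K] in
/-- `inr(Λ₂) ⊆ Λ₁₂`. [cite: BourbakiAlgebraI1989, Ch. III §7 no. 7 Prop. 10] -/
theorem inr_mem_span_prod_of_mem_span {v : W₂} (hv : v ∈ Submodule.span ℤ (Set.range b₂)) :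
    LinearMap.inr K W₁ W₂ v ∈ Submodule.span ℤ (Set.range ((b₁.prod b₂).reindex
      ((Equiv.sumSumSumComm (Fin g₁) (Fin g₁) (Fin g₂) (Fin g₂)).trans (Equiv.sumCongr finSumFinEquiv finSumFinEquiv)))) := by
  rw [Module.Basis.range_reindex]
  induction hv using Submodule.span_induction with
  | mem w hw =>
    obtain ⟨j, rfl⟩ := hw
    refine Submodule.subset_span ⟨Sum.inr j, ?_⟩
    rw [Module.Basis.prod_apply, Sum.elim_inr, Function.comp_apply]
  | zero => rw [map_zero]; exact Submodule.zero_mem _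
  | add w w' _ _ hw hw' => rw [map_add]; exact Submodule.add_mem _ hw hw'
  | smul n w _ hw => rw [map_zsmul]; exact Submodule.smul_mem _ n hw

omit [CharZero K] in
/-- **`p^*L₁ ⊆ L(b₁₂)`**: `p^* = ⋀(inl)` is a ring map sending the generators `ι(Λ₁)` of `L₁` into `ι(Λ₁₂)`.
[cite: BourbakiAlgebraI1989, Ch. III §7 no. 7 Prop. 10 and no. 2 (functoriality of ⋀)] -/
theorem map_inl_mem_span_weightBasis_prod {x : ExteriorAlgebra K W₁} (hx : x ∈ Submodule.span ℤ (Set.range (weightBasis b₁))) :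
    ExteriorAlgebra.map (LinearMap.inl K W₁ W₂) x ∈ Submodule.span ℤ (Set.range (weightBasis ((b₁.prod b₂).reindex
      ((Equiv.sumSumSumComm (Fin g₁) (Fin g₁) (Fin g₂) (Fin g₂)).trans (Equiv.sumCongr finSumFinEquiv finSumFinEquiv))))) := by
  rw [mem_span_weightBasis_iff_mem_closure] at hx ⊢
  induction hx using Subring.closure_induction with
  | mem y hy =>
    obtain ⟨v, hv, rfl⟩ := hy
    rw [ExteriorAlgebra.map_apply_ι]
    exact Subring.subset_closure ⟨_, inl_mem_span_prod_of_mem_span b₁ b₂ hv, rfl⟩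
  | zero => rw [map_zero]; exact Subring.zero_mem _
  | one => rw [map_one]; exact Subring.one_mem _
  | add y z _ _ hy hz => rw [map_add]; exact Subring.add_mem _ hy hz
  | neg y _ hy => rw [map_neg]; exact Subring.neg_mem _ hy
  | mul y z _ _ hy hz => rw [map_mul]; exact Subring.mul_mem _ hy hz

omit [CharZero K] in
/-- **`q^*L₂ ⊆ L(b₁₂)`**. [cite: BourbakiAlgebraI1989, Ch. III §7 no. 7 Prop. 10 and no. 2 (functoriality of ⋀)] -/
theorem map_inr_mem_span_weightBasis_prod {y : ExteriorAlgebra K W₂} (hy : y ∈ Submodule.span ℤ (Set.range (weightBasis b₂))) :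
    ExteriorAlgebra.map (LinearMap.inr K W₁ W₂) y ∈ Submodule.span ℤ (Set.range (weightBasis ((b₁.prod b₂).reindex
      ((Equiv.sumSumSumComm (Fin g₁) (Fin g₁) (Fin g₂) (Fin g₂)).trans (Equiv.sumCongr finSumFinEquiv finSumFinEquiv))))) := by
  rw [mem_span_weightBasis_iff_mem_closure] at hy ⊢
  induction hy using Subring.closure_induction with
  | mem z hz =>
    obtain ⟨v, hv, rfl⟩ := hz
    rw [ExteriorAlgebra.map_apply_ι]
    exact Subring.subset_closure ⟨_, inr_mem_span_prod_of_mem_span b₁ b₂ hv, rfl⟩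
  | zero => rw [map_zero]; exact Subring.zero_mem _
  | one => rw [map_one]; exact Subring.one_mem _
  | add z z' _ _ hz hz' => rw [map_add]; exact Subring.add_mem _ hz hz'
  | neg z _ hz => rw [map_neg]; exact Subring.neg_mem _ hz
  | mul z z' _ _ hz hz' => rw [map_mul]; exact Subring.mul_mem _ hz hz'

omit [CharZero K] in
/-- **INTEGRAL KÜNNETH: `H•(X₁ × X₂, ℤ) = H•(X₁, ℤ) ⊗ H•(X₂, ℤ)`** — for the concatenated Darboux basis `b₁₂` of `W₁ × W₂` (2-vector
`θ₁ ⊞ θ₂`), the integral lattice `L(b₁₂) = span_ℤ {w_A(b₁₂)}` IS the Künneth lattice `span_ℤ {p^*w_A(b₁) ∧ q^*w_B(b₂)}`: "the canonical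
homomorphism `⋀(M) ᵍ⊗ ⋀(N) → ⋀(M ⊕ N)` is an isomorphism of graded algebras" over `ℤ`, read inside `⋀_K(W₁ × W₂)`.
[cite: BourbakiAlgebraI1989, Ch. III §7 no. 7 Prop. 10] [cite: Lange2023AbelianVarietiesComplex, §1.1.3 Lemma 1.1.17 and Exercise 1.1.6 (7)] -/
theorem span_weightBasis_prod_eq_kunnethSpan :
    Submodule.span ℤ (Set.range (weightBasis ((b₁.prod b₂).reindex
      ((Equiv.sumSumSumComm (Fin g₁) (Fin g₁) (Fin g₂) (Fin g₂)).trans (Equiv.sumCongr finSumFinEquiv finSumFinEquiv))))) =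
      Submodule.span ℤ (Set.image2 (fun x y ↦ ExteriorAlgebra.map (LinearMap.inl K W₁ W₂) x * ExteriorAlgebra.map (LinearMap.inr K W₁ W₂) y)
        (Set.range (weightBasis b₁)) (Set.range (weightBasis b₂))) := by
  refine le_antisymm (fun u hu ↦ mem_kunnethSpan_of_mem_span_weightBasis_prod b₁ b₂ hu) (Submodule.span_le.2 ?_)
  rintro _ ⟨x, ⟨A, rfl⟩, y, ⟨B, rfl⟩, rfl⟩
  exact mul_mem_span_weightBasis _ (map_inl_mem_span_weightBasis_prod b₁ b₂ (Submodule.subset_span ⟨A, rfl⟩))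
    (map_inr_mem_span_weightBasis_prod b₁ b₂ (Submodule.subset_span ⟨B, rfl⟩))

/-! ## §3 Integral correspondences act integrally: `ū(H•(X₁, ℤ)) ⊆ H•(X₂, ℤ)` for `u ∈ H•(X₁ × X₂, ℤ)` -/

/-- **An integral correspondence acts integrally**: for `u` in the Künneth lattice `L₁ ⊠ L₂` and `x ∈ L₁ = H•(X₁, ℤ)`, Milne's
`ū(x) = q_*(p^*x ∧ u)` lies in `L₂ = H•(X₂, ℤ)` — on generators `ū(x) = q_*(p^*(x ∧ w_A) ∧ q^*w_B) = τ_{θ₁}(x ∧ w_A) · w_B` with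
`τ_{θ₁}(x ∧ w_A) ∈ ℤ` (unimodularity of the integral Poincaré pairing, g39-#2). [cite: Milne1999LefschetzClasses, §5 p. 664 (u ↦ ū)]
[cite: Lange2023AbelianVarietiesComplex, §1.1.3 Lemma 1.1.17] -/
theorem corrMap_mem_span_weightBasis {u : ExteriorAlgebra K (W₁ × W₂)}
    (hu : u ∈ Submodule.span ℤ (Set.image2 (fun x y ↦ ExteriorAlgebra.map (LinearMap.inl K W₁ W₂) x * ExteriorAlgebra.map (LinearMap.inr K W₁ W₂) y)
        (Set.range (weightBasis b₁)) (Set.range (weightBasis b₂))))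
    {x : ExteriorAlgebra K W₁} (hx : x ∈ Submodule.span ℤ (Set.range (weightBasis b₁))) :
    corrMap (twoVector b₁) g₁ u x ∈ Submodule.span ℤ (Set.range (weightBasis b₂)) := by
  rw [corrMap_apply]
  induction hu using Submodule.span_induction with
  | mem u hu =>
    obtain ⟨a, ⟨A, rfl⟩, c, ⟨B, rfl⟩, rfl⟩ := hu
    obtain ⟨n, hn⟩ := exists_trace_mul_eq_intCast_of_mem_span_weightBasis b₁ hx (Submodule.subset_span ⟨A, rfl⟩ :
      weightBasis b₁ A ∈ Submodule.span ℤ (Set.range (weightBasis b₁)))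
    rw [← mul_assoc, ← map_mul, gysinSnd_map_inl_mul_map_inr, hn, Int.cast_smul_eq_zsmul]
    exact Submodule.smul_mem _ n (Submodule.subset_span ⟨B, rfl⟩)
  | zero => rw [mul_zero, map_zero]; exact Submodule.zero_mem _
  | add u v _ _ hu hv => rw [mul_add, map_add]; exact Submodule.add_mem _ hu hv
  | smul n u _ hu => rw [mul_smul_comm, map_zsmul]; exact Submodule.smul_mem _ n hu

/-- **`ū(H•(X₁, ℤ)) ⊆ H•(X₂, ℤ)` for every integral class `u ∈ H•(X₁ × X₂, ℤ) = L(b₁₂)`** (the concatenated Darboux basis).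
[cite: Milne1999LefschetzClasses, §5 p. 664 (u ↦ ū)] [cite: BourbakiAlgebraI1989, Ch. III §7 no. 7 Prop. 10] -/
theorem corrMap_mem_span_weightBasis_of_mem_span_prod {u : ExteriorAlgebra K (W₁ × W₂)}
    (hu : u ∈ Submodule.span ℤ (Set.range (weightBasis ((b₁.prod b₂).reindex
      ((Equiv.sumSumSumComm (Fin g₁) (Fin g₁) (Fin g₂) (Fin g₂)).trans (Equiv.sumCongr finSumFinEquiv finSumFinEquiv))))))
    {x : ExteriorAlgebra K W₁} (hx : x ∈ Submodule.span ℤ (Set.range (weightBasis b₁))) :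
    corrMap (twoVector b₁) g₁ u x ∈ Submodule.span ℤ (Set.range (weightBasis b₂)) :=
  corrMap_mem_span_weightBasis b₁ b₂ (mem_kunnethSpan_of_mem_span_weightBasis_prod b₁ b₂ hu) hx

/-- **The trace of `X₁ × X₂` is integral on the Künneth lattice**: `τ_{θ₁ ⊞ θ₂}(u) ∈ ℤ` for `u ∈ L₁ ⊠ L₂` (`θ₁ ⊞ θ₂ = p^*θ₁ + q^*θ₂` is
the 2-vector of the concatenated Darboux basis, g36 `twoVector_prod_reindex`, and g39-#2 `τ(H•(X, ℤ)) ⊆ ℤ`).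
[cite: Lange2023AbelianVarietiesComplex, §1.1.3 Lemma 1.1.17 and Exercise 1.1.6 (8)] [cite: BourbakiAlgebraI1989, Ch. III §7 no. 7 Prop. 10] -/
theorem exists_trace_inl_add_inr_eq_intCast {u : ExteriorAlgebra K (W₁ × W₂)}
    (hu : u ∈ Submodule.span ℤ (Set.image2 (fun x y ↦ ExteriorAlgebra.map (LinearMap.inl K W₁ W₂) x * ExteriorAlgebra.map (LinearMap.inr K W₁ W₂) y)
        (Set.range (weightBasis b₁)) (Set.range (weightBasis b₂)))) :
    ∃ n : ℤ, trace (ExteriorAlgebra.map (LinearMap.inl K W₁ W₂) (twoVector b₁) + ExteriorAlgebra.map (LinearMap.inr K W₁ W₂) (twoVector b₂))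
      (g₁ + g₂) u = n := by
  rw [← span_weightBasis_prod_eq_kunnethSpan] at hu
  rw [← twoVector_prod_reindex]
  exact exists_trace_eq_intCast_of_mem_span_weightBasis _ hu

end ExteriorLefschetz

end Literature.AlgebraicGeometry.Motives
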